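import Mathlib
import Summits.RiemannHypothesis.RiemannHypothesis.Theorems.IntegerScrewChebyshevAbel
import Summits.RiemannHypothesis.RiemannHypothesis.Theorems.IntegerScrewExitGreenLower
import HarnessLib

/-!
# Route `IntegerScrew` — the tail sums `Σ'' = Σ_{Q/b<n≤R/b}(Λ(n)/n)/log²(bn)` of the exit density, two-sided at
# Chebyshev strength (CONTINUUM-LIMIT §25.4 (b), first half)

For the exit density of the exit-death chain (`IntegerScrewExitFlow`, `IntegerScrewExitDensity`) one needs
`Σ''(b) := Σ_{Q/b < n ≤ R/b} (Λ(n)/n)/log²(bn)` to RELATIVE accuracy `O(1/log P)`.  The device: the two-sided Abel step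
(`IntegerScrewChebyshevAbel`, `IntegerScrewExitGreenLower`) applied on `[1, R/b]` and `[1, Q/b]` to the TRUNCATED
weight `f̃(t) = 1/(log b + max(t, log(Q/b+1)))²` — antitone, equal to `1/log²(bn)` on the range, and bounded by
`1/log²(Q+1)` below it (no singularity at `n = 1` even for `b = 1`):

* `truncWeight` and its elementary properties;
* `exitTail_eq` — `Σ'' = Σ_{n≤R/b}(Λ/n)f̃(log n) − Σ_{n≤Q/b}(Λ/n)f̃(log n)`;
* `integral_truncWeight_le` / `le_integral_truncWeight` — `∫_{log(Q/b)}^{log(R/b)} f̃` against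
  `1/log(b(Q/b+1)) − 1/(log b + log(R/b))`;
* **`exitTail_le`** — `Σ'' ≤ 1/log(Q+1) − 1/log R + (39/50 + c′ + 2 log 2)/log²(Q+1)` (`1 ≤ b ≤ Q`, `2Q ≤ R`);
* **`le_exitTail`** — `Σ'' ≥ 1/log(2Q) − 1/(log R − log 2) − (39/50 + c′ + log 2)/log²(Q+1)` (`2 ≤ Q`, `2Q ≤ R`),

`c′` a lower Mertens constant (`c′ = 1` by `Literature…MertensFirstLower`); the main terms agree to relative
`O(1/log P + 1/log Q)` — «Chebyshev strength suffices» (CONTINUUM-LIMIT 25.5) in the kernel.  RH-free, elementary.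
Nothing here bears on the truth of RH.  Refs: CONTINUUM-LIMIT §25.4; Suzuki, JLMS (2) 108 (2023) 1448–1487 [Suzuki2023].
-/

noncomputable section

set_option linter.dupNamespace false -- D-0017: `Summit.<S>.<S>.…` is the designed namespace

namespace Summit.RiemannHypothesis.RiemannHypothesis.Theorems.IntegerScrew

open Finset Real
open ArithmeticFunction (vonMangoldt)

/-! ### The truncated weight -/

/-- The truncated weight in the real variable: `f̃(t) = 1/(log b + max(t, log M))²`.
[cite: Suzuki2023, §1 (the screw matrices S_M whose pivot/spectral theory this serves)] -/
def truncWeight (b M : ℕ) (t : ℝ) : ℝ := 1 / (Real.log b + max t (Real.log M)) ^ 2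

/-- `f̃ ≥ 0`. -/
theorem truncWeight_nonneg (b M : ℕ) (t : ℝ) : 0 ≤ truncWeight b M t := by
  unfold truncWeight; positivity

/-- `log b + log M > 0` when `b ≥ 1` and `b·M ≥ 2`. -/
theorem log_add_log_pos {b M : ℕ} (hb : 1 ≤ b) (hbM : 2 ≤ b * M) : 0 < Real.log b + Real.log M := by
  have hM1 : 1 ≤ M := by
    rcases Nat.eq_zero_or_pos M with h | h
    · subst h; simp at hbM
    · exact h
  rw [← Real.log_mul (by positivity) (by positivity)]
  exact Real.log_pos (by exact_mod_cast (show 1 < b * M by omega))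

/-- `f̃` is antitone on every `[0, T]` (`b ≥ 1`, `b·M ≥ 2`). -/
theorem truncWeight_antitoneOn {b M : ℕ} (hb : 1 ≤ b) (hbM : 2 ≤ b * M) (T : ℝ) :
    AntitoneOn (truncWeight b M) (Set.Icc 0 T) := by
  intro x _ y _ hxy
  unfold truncWeight
  have hpos := log_add_log_pos hb hbM
  have hx0 : 0 < Real.log b + max x (Real.log M) :=
    lt_of_lt_of_le hpos (by linarith [le_max_right x (Real.log M)])
  refine div_le_div_of_nonneg_left zero_le_one (by positivity) ?_
  have : max x (Real.log M) ≤ max y (Real.log M) := max_le_max hxy le_rfl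
  nlinarith

/-- `f̃(0) = 1/log²(b·M)` (`M ≥ 1`, `b ≥ 1`). -/
theorem truncWeight_zero {b M : ℕ} (hb : 1 ≤ b) (hM : 1 ≤ M) :
    truncWeight b M 0 = 1 / Real.log ((b * M : ℕ) : ℝ) ^ 2 := by
  unfold truncWeight
  rw [max_eq_right (Real.log_nonneg (by exact_mod_cast hM)), Nat.cast_mul,
    Real.log_mul (by positivity) (by positivity)]

/-- On `n ≥ M ≥ 1`: `f̃(log n) = 1/log²(bn)` (`b ≥ 1`). -/
theorem truncWeight_log_of_le {b M n : ℕ} (hb : 1 ≤ b) (hM : 1 ≤ M) (hn : M ≤ n) :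
    truncWeight b M (Real.log n) = 1 / Real.log ((b * n : ℕ) : ℝ) ^ 2 := by
  unfold truncWeight
  have hmax : max (Real.log (n : ℝ)) (Real.log M) = Real.log n :=
    max_eq_left (Real.log_le_log (by exact_mod_cast hM) (by exact_mod_cast hn))
  have hn0 : (0:ℝ) < n := by exact_mod_cast (show 0 < n by omega)
  rw [hmax, Nat.cast_mul, Real.log_mul (by positivity) hn0.ne']

/-- On `t ≤ log M`: `f̃(t) = 1/log²(b·M)` (`b, M ≥ 1`). -/
theorem truncWeight_of_le {b M : ℕ} (hb : 1 ≤ b) (hM : 1 ≤ M) {t : ℝ} (ht : t ≤ Real.log M) :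
    truncWeight b M t = 1 / Real.log ((b * M : ℕ) : ℝ) ^ 2 := by
  unfold truncWeight
  rw [max_eq_right ht, Nat.cast_mul, Real.log_mul (by positivity) (by positivity)]

/-- On `t ≥ log M`: `f̃(t) = 1/(log b + t)²`. -/
theorem truncWeight_of_ge {b M : ℕ} {t : ℝ} (ht : Real.log M ≤ t) :
    truncWeight b M t = 1 / (Real.log b + t) ^ 2 := by
  unfold truncWeight
  rw [max_eq_left ht]

/-! ### The tail sum `Σ''` and its two-sided bounds -/

/-- `Σ''(b) = Σ_{n ≤ R/b} (Λ(n)/n) f̃(log n) − Σ_{n ≤ Q/b} (Λ(n)/n) f̃(log n)` with `M = Q/b + 1`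
(for `1 ≤ b ≤ Q ≤ R`). -/
theorem exitTail_eq {R Q b : ℕ} (hb : 1 ≤ b) (hQR : Q ≤ R) :
    ∑ n ∈ (Icc 1 (R / b)).filter (fun n => Q / b < n), vonMangoldt n / n * (1 / Real.log ((b * n : ℕ) : ℝ) ^ 2) =
    ∑ n ∈ Icc 1 (R / b), vonMangoldt n / n * truncWeight b (Q / b + 1) (Real.log n) -
      ∑ n ∈ Icc 1 (Q / b), vonMangoldt n / n * truncWeight b (Q / b + 1) (Real.log n) := by
  have hle : Q / b ≤ R / b := Nat.div_le_div_right hQR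
  have hsplit : Icc 1 (R / b) = Icc 1 (Q / b) ∪ (Icc 1 (R / b)).filter (fun n => Q / b < n) := by
    ext n; simp only [Finset.mem_union, Finset.mem_Icc, Finset.mem_filter]; omega
  have hdisj : Disjoint (Icc 1 (Q / b)) ((Icc 1 (R / b)).filter (fun n => Q / b < n)) := by
    rw [Finset.disjoint_left]; intro n hn hn'
    simp only [Finset.mem_Icc] at hn; simp only [Finset.mem_filter, Finset.mem_Icc] at hn'; omega
  have hsum : ∑ n ∈ Icc 1 (R / b), vonMangoldt n / n * truncWeight b (Q / b + 1) (Real.log n) =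
      ∑ n ∈ Icc 1 (Q / b), vonMangoldt n / n * truncWeight b (Q / b + 1) (Real.log n) +
        ∑ n ∈ (Icc 1 (R / b)).filter (fun n => Q / b < n),
          vonMangoldt n / n * truncWeight b (Q / b + 1) (Real.log n) := by
    rw [← Finset.sum_union hdisj, ← hsplit]
  rw [hsum, add_sub_cancel_left]
  refine Finset.sum_congr rfl fun n hn => ?_
  have hn' := Finset.mem_filter.1 hn
  rw [truncWeight_log_of_le hb (Nat.succ_le_succ (Nat.zero_le _)) (Nat.lt_iff_add_one_le.mp hn'.2)]

/-- The two pieces of `∫_{log N₂}^{log N₁} f̃` (`M = N₂+1`, `1 ≤ N₂ < N₁`, `b ≥ 1`): it splits at `log M` into a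
constant piece `(log M − log N₂)/log²(bM)` and `∫_{log M}^{log N₁} dt/(log b + t)² = 1/(log b + log M) − 1/(log b + log N₁)`. -/
theorem integral_truncWeight_eq {b N₁ N₂ : ℕ} (hb : 1 ≤ b) (hN₂ : 1 ≤ N₂) (h12 : N₂ < N₁) :
    ∫ t in Real.log N₂..Real.log N₁, truncWeight b (N₂ + 1) t =
      (Real.log ((N₂ + 1 : ℕ) : ℝ) - Real.log N₂) * (1 / Real.log ((b * (N₂ + 1) : ℕ) : ℝ) ^ 2) +
        (1 / (Real.log b + Real.log ((N₂ + 1 : ℕ) : ℝ)) - 1 / (Real.log b + Real.log N₁)) := by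
  set M := N₂ + 1 with hM
  have hM1 : 1 ≤ M := by omega
  have hbM : 2 ≤ b * M := by nlinarith
  have hN2pos : (0:ℝ) < N₂ := by exact_mod_cast (show 0 < N₂ by omega)
  have hlN2 : 0 ≤ Real.log (N₂:ℝ) := Real.log_natCast_nonneg N₂
  have hl1 : Real.log (N₂:ℝ) ≤ Real.log (M:ℝ) := Real.log_le_log hN2pos (by simp [hM])
  have hl2 : Real.log (M:ℝ) ≤ Real.log (N₁:ℝ) :=
    Real.log_le_log (by exact_mod_cast (show 0 < M by omega)) (by exact_mod_cast (show M ≤ N₁ by omega))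
  have hposM : 0 < Real.log (b:ℝ) + Real.log M := log_add_log_pos hb hbM
  have hanti := truncWeight_antitoneOn hb hbM (Real.log N₁)
  have hi1 : IntervalIntegrable (truncWeight b M) MeasureTheory.volume (Real.log N₂) (Real.log M) := by
    refine (hanti.mono ?_).intervalIntegrable
    rw [Set.uIcc_of_le hl1]; exact Set.Icc_subset_Icc hlN2 hl2
  have hi2 : IntervalIntegrable (truncWeight b M) MeasureTheory.volume (Real.log M) (Real.log N₁) := by
    refine (hanti.mono ?_).intervalIntegrable
    rw [Set.uIcc_of_le hl2]; exact Set.Icc_subset_Icc (hlN2.trans hl1) le_rfl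
  rw [← intervalIntegral.integral_add_adjacent_intervals hi1 hi2]
  have hp1 : ∫ t in Real.log N₂..Real.log M, truncWeight b M t =
      (Real.log M - Real.log N₂) * (1 / Real.log ((b * M : ℕ) : ℝ) ^ 2) := by
    rw [intervalIntegral.integral_congr (g := fun _ => 1 / Real.log ((b * M : ℕ) : ℝ) ^ 2)
      (fun t ht => by
        rw [Set.uIcc_of_le hl1] at ht
        exact truncWeight_of_le hb hM1 ht.2)]
    rw [intervalIntegral.integral_const, smul_eq_mul]
  have hp2 : ∫ t in Real.log M..Real.log N₁, truncWeight b M t =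
      1 / (Real.log b + Real.log M) - 1 / (Real.log b + Real.log N₁) := by
    rw [intervalIntegral.integral_congr (g := fun t => 1 / (Real.log b + t) ^ 2)
      (fun t ht => by
        rw [Set.uIcc_of_le hl2] at ht
        exact truncWeight_of_ge ht.1)]
    have hderiv : ∀ t ∈ Set.uIcc (Real.log (M:ℝ)) (Real.log N₁),
        HasDerivAt (fun t => -(1 / (Real.log b + t))) (1 / (Real.log b + t) ^ 2) t := by
      intro t ht
      rw [Set.uIcc_of_le hl2] at ht
      have hst : Real.log b + t ≠ 0 := by linarith [ht.1]
      have h1 : HasDerivAt (fun y : ℝ => Real.log b + y) 1 t := (hasDerivAt_id t).const_add _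
      have h3 : HasDerivAt (fun y : ℝ => -(1:ℝ) * (Real.log b + y)⁻¹) (-(1:ℝ) * (-1 / (Real.log b + t) ^ 2)) t :=
        (h1.inv hst).const_mul (-1)
      have hfun : (fun t => -(1 / (Real.log (b:ℝ) + t))) = fun y => -(1:ℝ) * (Real.log b + y)⁻¹ := by
        funext y; ring
      rw [hfun]
      refine h3.congr_deriv ?_
      field_simp
    have hcont : ContinuousOn (fun t => 1 / (Real.log (b:ℝ) + t) ^ 2) (Set.uIcc (Real.log (M:ℝ)) (Real.log N₁)) := by
      refine ContinuousOn.div continuousOn_const (by fun_prop) ?_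
      intro t ht
      rw [Set.uIcc_of_le hl2] at ht
      have : 0 < Real.log b + t := by linarith [ht.1]
      positivity
    rw [intervalIntegral.integral_eq_sub_of_hasDerivAt hderiv hcont.intervalIntegrable]
    ring
  rw [hp1, hp2]

/-- `∫_{log N₂}^{log N₁} f̃ ≤ log 2/log²(b(N₂+1)) + (1/log(b(N₂+1)) − 1/(log b + log N₁))`
(`log(N₂+1) − log N₂ ≤ log 2`). -/
theorem integral_truncWeight_le {b N₁ N₂ : ℕ} (hb : 1 ≤ b) (hN₂ : 1 ≤ N₂) (h12 : N₂ < N₁) :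
    ∫ t in Real.log N₂..Real.log N₁, truncWeight b (N₂ + 1) t ≤
      Real.log 2 / Real.log ((b * (N₂ + 1) : ℕ) : ℝ) ^ 2 +
        (1 / Real.log ((b * (N₂ + 1) : ℕ) : ℝ) - 1 / (Real.log b + Real.log N₁)) := by
  rw [integral_truncWeight_eq hb hN₂ h12]
  have hN2pos : (0:ℝ) < N₂ := by exact_mod_cast (show 0 < N₂ by omega)
  have hlogM_sub : Real.log ((N₂ + 1 : ℕ) : ℝ) - Real.log N₂ ≤ Real.log 2 := by
    rw [← Real.log_div (by positivity) hN2pos.ne']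
    refine Real.log_le_log (by positivity) ?_
    rw [div_le_iff₀ hN2pos]
    have : (1:ℝ) ≤ N₂ := by exact_mod_cast hN₂
    push_cast; linarith
  have hlogbM : Real.log ((b * (N₂ + 1) : ℕ) : ℝ) = Real.log b + Real.log ((N₂ + 1 : ℕ) : ℝ) := by
    rw [Nat.cast_mul, Real.log_mul (by positivity) (by positivity)]
  rw [← hlogbM]
  have hsq : 0 ≤ 1 / Real.log ((b * (N₂ + 1) : ℕ) : ℝ) ^ 2 := by positivity
  have := mul_le_mul_of_nonneg_right hlogM_sub hsq
  rw [← div_eq_mul_one_div (Real.log 2)] at this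
  linarith

/-- `∫_{log N₂}^{log N₁} f̃ ≥ 1/(log b + log(N₂+1)) − 1/(log b + log N₁)` (drop the non-negative constant piece). -/
theorem le_integral_truncWeight {b N₁ N₂ : ℕ} (hb : 1 ≤ b) (hN₂ : 1 ≤ N₂) (h12 : N₂ < N₁) :
    1 / (Real.log b + Real.log ((N₂ + 1 : ℕ) : ℝ)) - 1 / (Real.log b + Real.log N₁) ≤
      ∫ t in Real.log N₂..Real.log N₁, truncWeight b (N₂ + 1) t := by
  rw [integral_truncWeight_eq hb hN₂ h12]
  have hN2pos : (0:ℝ) < N₂ := by exact_mod_cast (show 0 < N₂ by omega)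
  have h1 : 0 ≤ Real.log ((N₂ + 1 : ℕ) : ℝ) - Real.log N₂ := by
    have := Real.log_le_log hN2pos (by exact_mod_cast (show N₂ ≤ N₂ + 1 by omega) : (N₂:ℝ) ≤ ((N₂ + 1 : ℕ) : ℝ))
    linarith
  have h2 : 0 ≤ (Real.log ((N₂ + 1 : ℕ) : ℝ) - Real.log N₂) * (1 / Real.log ((b * (N₂ + 1) : ℕ) : ℝ) ^ 2) :=
    mul_nonneg h1 (by positivity)
  linarith

/-- **Upper bound for the tail sum** (`1 ≤ b ≤ Q ≤ R`, lower Mertens constant `c′`):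
`Σ''(b) ≤ 1/log(Q+1) − 1/log R + (39/50 + c′ + 2 log 2)/log²(Q+1)`. -/
theorem exitTail_le {R Q b : ℕ} (hb : 1 ≤ b) (hbQ : b ≤ Q) (hQR : 2 * Q ≤ R) {c' : ℝ}
    (hψ : ∀ n, 1 ≤ n → n ≤ R → Real.log n - c' ≤ ∑ k ∈ Icc 1 n, vonMangoldt k / k) :
    ∑ n ∈ (Icc 1 (R / b)).filter (fun n => Q / b < n), vonMangoldt n / n * (1 / Real.log ((b * n : ℕ) : ℝ) ^ 2) ≤
      1 / Real.log ((Q : ℝ) + 1) - 1 / Real.log R + (39 / 50 + c' + 2 * Real.log 2) / Real.log ((Q : ℝ) + 1) ^ 2 := by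
  set N₁ := R / b with hN₁
  set N₂ := Q / b with hN₂
  set M := N₂ + 1 with hM
  have hN₂1 : 1 ≤ N₂ := (Nat.le_div_iff_mul_le (by omega)).2 (by simpa using hbQ)
  have hbN₂ : b * N₂ ≤ Q := by rw [mul_comm]; exact Nat.div_mul_le_self Q b
  have heM : b * M = b * N₂ + b := by rw [hM]; ring
  have hbMR : b * M ≤ R := by omega
  have hN₁2 : N₂ < N₁ := by
    have : M ≤ R / b := (Nat.le_div_iff_mul_le (by omega)).2 (by rw [mul_comm]; exact hbMR)
    omega
  have hN₁1 : 1 ≤ N₁ := by omega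
  have hbM : 2 ≤ b * M := by nlinarith
  have hM1 : 1 ≤ M := by omega
  rw [exitTail_eq hb (by omega)]
  have hanti1 := truncWeight_antitoneOn hb hbM (Real.log N₁)
  have hanti2 := truncWeight_antitoneOn hb hbM (Real.log ((N₂ : ℝ) + 1))
  have hup := sum_vonMangoldt_div_mul_comp_log_le_integral hN₁1 hanti1 (fun t _ => truncWeight_nonneg _ _ _)
  have hlo := integral_sub_le_sum_vonMangoldt_div_mul_comp_log hN₂1 (c' := c')
    (fun n hn hnN => hψ n hn (by
      have : N₂ ≤ R := (Nat.div_le_self Q b).trans (by omega)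
      omega)) hanti2 (fun t _ => truncWeight_nonneg _ _ _)
  have hanti0 := truncWeight_antitoneOn hb hbM (Real.log N₁)
  have hlN2N1 : Real.log (N₂:ℝ) ≤ Real.log N₁ :=
    Real.log_le_log (by exact_mod_cast (show 0 < N₂ by omega)) (by exact_mod_cast hN₁2.le)
  have hiA : IntervalIntegrable (truncWeight b M) MeasureTheory.volume 0 (Real.log N₂) := by
    refine (hanti0.mono ?_).intervalIntegrable
    rw [Set.uIcc_of_le (Real.log_natCast_nonneg N₂)]
    exact Set.Icc_subset_Icc le_rfl hlN2N1
  have hiB : IntervalIntegrable (truncWeight b M) MeasureTheory.volume (Real.log N₂) (Real.log N₁) := by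
    refine (hanti0.mono ?_).intervalIntegrable
    rw [Set.uIcc_of_le hlN2N1]
    exact Set.Icc_subset_Icc (Real.log_natCast_nonneg N₂) le_rfl
  have hadd := intervalIntegral.integral_add_adjacent_intervals hiA hiB
  have hmid := integral_truncWeight_le hb hN₂1 hN₁2
  rw [← hM] at hmid
  have h0 : truncWeight b M 0 = 1 / Real.log ((b * M : ℕ) : ℝ) ^ 2 := truncWeight_zero hb hM1
  have hbM_ge : (Q : ℝ) + 1 ≤ ((b * M : ℕ) : ℝ) := by
    have : Q + 1 ≤ b * M := by
      have h := Nat.lt_div_mul_add (a := Q) (b := b) (by omega)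
      have e : b * M = Q / b * b + b := by rw [hM, hN₂]; ring
      omega
    exact_mod_cast this
  have hlogQ1 : 0 < Real.log ((Q:ℝ) + 1) := Real.log_pos (by
    have : (1:ℝ) ≤ Q := by exact_mod_cast (show 1 ≤ Q by omega)
    linarith)
  have hlogbM : Real.log ((Q:ℝ) + 1) ≤ Real.log ((b * M : ℕ) : ℝ) := Real.log_le_log (by positivity) hbM_ge
  have hlogbM' : Real.log ((b * M : ℕ) : ℝ) = Real.log b + Real.log M := by
    push_cast; rw [Real.log_mul (by positivity) (by positivity)]
  have hinv1 : 1 / Real.log ((b * M : ℕ) : ℝ) ≤ 1 / Real.log ((Q:ℝ) + 1) :=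
    one_div_le_one_div_of_le hlogQ1 hlogbM
  have hinv2 : 1 / Real.log ((b * M : ℕ) : ℝ) ^ 2 ≤ 1 / Real.log ((Q:ℝ) + 1) ^ 2 :=
    one_div_le_one_div_of_le (by positivity) (pow_le_pow_left₀ hlogQ1.le hlogbM 2)
  have hb0r : (0:ℝ) < b := by exact_mod_cast (show 0 < b by omega)
  have hbN1 : Real.log (b:ℝ) + Real.log N₁ ≤ Real.log R := by
    have hN1pos : (0:ℝ) < N₁ := by exact_mod_cast (show 0 < N₁ by omega)
    rw [← Real.log_mul hb0r.ne' hN1pos.ne']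
    exact Real.log_le_log (mul_pos hb0r hN1pos) (by exact_mod_cast (show b * N₁ ≤ R from Nat.mul_div_le R b))
  have hbN1pos : 0 < Real.log (b:ℝ) + Real.log N₁ := by
    have := log_add_log_pos hb hbM
    have : Real.log (M:ℝ) ≤ Real.log N₁ :=
      Real.log_le_log (by exact_mod_cast (show 0 < M by omega)) (by exact_mod_cast (show M ≤ N₁ by omega))
    linarith
  have hinv3 : 1 / Real.log (R:ℝ) ≤ 1 / (Real.log b + Real.log N₁) :=
    one_div_le_one_div_of_le hbN1pos hbN1
  have hlog2 : 0 < Real.log 2 := Real.log_pos (by norm_num)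
  have hc' : 0 ≤ c' := by
    have := hψ 1 le_rfl (by omega)
    simp [ArithmeticFunction.vonMangoldt_apply_one] at this
    linarith
  rw [h0] at hup hlo
  have hmid' : ∫ t in Real.log N₂..Real.log N₁, truncWeight b M t ≤
      Real.log 2 / Real.log ((Q:ℝ) + 1) ^ 2 + (1 / Real.log ((Q:ℝ) + 1) - 1 / Real.log R) := by
    refine hmid.trans ?_
    have : Real.log 2 / Real.log ((b * M : ℕ) : ℝ) ^ 2 ≤ Real.log 2 / Real.log ((Q:ℝ) + 1) ^ 2 := by
      rw [div_eq_mul_one_div, div_eq_mul_one_div (Real.log 2)]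
      exact mul_le_mul_of_nonneg_left hinv2 hlog2.le
    linarith
  have hcoef : (39 / 50 + c' + 2 * Real.log 2) / Real.log ((Q:ℝ) + 1) ^ 2 =
      39 / 50 * (1 / Real.log ((Q:ℝ) + 1) ^ 2) + (c' + Real.log 2) * (1 / Real.log ((Q:ℝ) + 1) ^ 2) +
        Real.log 2 / Real.log ((Q:ℝ) + 1) ^ 2 := by ring
  rw [hcoef]
  nlinarith [hup, hlo, hadd, hmid', hinv2, hc', hlog2.le,
    mul_le_mul_of_nonneg_left hinv2 (by positivity : (0:ℝ) ≤ 39 / 50),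
    mul_le_mul_of_nonneg_left hinv2 (by positivity : (0:ℝ) ≤ c' + Real.log 2)]

/-- **Lower bound for the tail sum** (`1 ≤ b ≤ Q`, `2Q ≤ R`, lower Mertens constant `c′`):
`Σ''(b) ≥ 1/log(2Q) − 1/(log R − log 2) − (39/50 + c′ + log 2)/log²(Q+1)`. -/
theorem le_exitTail {R Q b : ℕ} (hb : 1 ≤ b) (hbQ : b ≤ Q) (hQ2 : 2 ≤ Q) (hQR : 2 * Q ≤ R) {c' : ℝ}
    (hψ : ∀ n, 1 ≤ n → n ≤ R → Real.log n - c' ≤ ∑ k ∈ Icc 1 n, vonMangoldt k / k) :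
    1 / Real.log (2 * (Q : ℝ)) - 1 / (Real.log R - Real.log 2) - (39 / 50 + c' + Real.log 2) / Real.log ((Q : ℝ) + 1) ^ 2 ≤
      ∑ n ∈ (Icc 1 (R / b)).filter (fun n => Q / b < n), vonMangoldt n / n * (1 / Real.log ((b * n : ℕ) : ℝ) ^ 2) := by
  set N₁ := R / b with hN₁
  set N₂ := Q / b with hN₂
  set M := N₂ + 1 with hM
  have hQ1 : 1 ≤ Q := by omega
  have hN₂1 : 1 ≤ N₂ := (Nat.le_div_iff_mul_le (by omega)).2 (by simpa using hbQ)
  have hbN₂ : b * N₂ ≤ Q := by rw [mul_comm]; exact Nat.div_mul_le_self Q b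
  have heM : b * M = b * N₂ + b := by rw [hM]; ring
  have hbM_le : b * M ≤ 2 * Q := by omega
  have hN₁2 : N₂ < N₁ := by
    have : M ≤ R / b := (Nat.le_div_iff_mul_le (by omega)).2 (by rw [mul_comm]; omega)
    omega
  have hN₁1 : 1 ≤ N₁ := by omega
  have hbM : 2 ≤ b * M := by nlinarith
  have hM1 : 1 ≤ M := by omega
  rw [exitTail_eq hb (by omega)]
  have hanti1 := truncWeight_antitoneOn hb hbM (Real.log ((N₁ : ℝ) + 1))
  have hanti2 := truncWeight_antitoneOn hb hbM (Real.log N₂)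
  have hlo := integral_sub_le_sum_vonMangoldt_div_mul_comp_log hN₁1 (c' := c')
    (fun n hn hnN => hψ n hn (hnN.trans (Nat.div_le_self R b))) hanti1 (fun t _ => truncWeight_nonneg _ _ _)
  have hup := sum_vonMangoldt_div_mul_comp_log_le_integral hN₂1 hanti2 (fun t _ => truncWeight_nonneg _ _ _)
  have hanti0 := truncWeight_antitoneOn hb hbM (Real.log N₁)
  have hlN2N1 : Real.log (N₂:ℝ) ≤ Real.log N₁ :=
    Real.log_le_log (by exact_mod_cast (show 0 < N₂ by omega)) (by exact_mod_cast hN₁2.le)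
  have hiA : IntervalIntegrable (truncWeight b M) MeasureTheory.volume 0 (Real.log N₂) := by
    refine (hanti0.mono ?_).intervalIntegrable
    rw [Set.uIcc_of_le (Real.log_natCast_nonneg N₂)]
    exact Set.Icc_subset_Icc le_rfl hlN2N1
  have hiB : IntervalIntegrable (truncWeight b M) MeasureTheory.volume (Real.log N₂) (Real.log N₁) := by
    refine (hanti0.mono ?_).intervalIntegrable
    rw [Set.uIcc_of_le hlN2N1]
    exact Set.Icc_subset_Icc (Real.log_natCast_nonneg N₂) le_rfl
  have hadd := intervalIntegral.integral_add_adjacent_intervals hiA hiB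
  have hmid := le_integral_truncWeight hb hN₂1 hN₁2
  rw [← hM] at hmid
  have h0 : truncWeight b M 0 = 1 / Real.log ((b * M : ℕ) : ℝ) ^ 2 := truncWeight_zero hb hM1
  have hbM_ge : (Q : ℝ) + 1 ≤ ((b * M : ℕ) : ℝ) := by
    have : Q + 1 ≤ b * M := by
      have h := Nat.lt_div_mul_add (a := Q) (b := b) (by omega)
      have e : b * M = Q / b * b + b := by rw [hM, hN₂]; ring
      omega
    exact_mod_cast this
  have hlogQ1 : 0 < Real.log ((Q:ℝ) + 1) := Real.log_pos (by
    have : (1:ℝ) ≤ Q := by exact_mod_cast hQ1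
    linarith)
  have hlogbM : Real.log ((Q:ℝ) + 1) ≤ Real.log ((b * M : ℕ) : ℝ) := Real.log_le_log (by positivity) hbM_ge
  have hinv2 : 1 / Real.log ((b * M : ℕ) : ℝ) ^ 2 ≤ 1 / Real.log ((Q:ℝ) + 1) ^ 2 :=
    one_div_le_one_div_of_le (by positivity) (pow_le_pow_left₀ hlogQ1.le hlogbM 2)
  have hb0r : (0:ℝ) < b := by exact_mod_cast (show 0 < b by omega)
  have hlogbM' : Real.log (b:ℝ) + Real.log ((M : ℕ) : ℝ) ≤ Real.log (2 * (Q:ℝ)) := by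
    have hMpos : (0:ℝ) < ((M : ℕ) : ℝ) := by exact_mod_cast (show 0 < M by omega)
    rw [← Real.log_mul hb0r.ne' hMpos.ne']
    exact Real.log_le_log (mul_pos hb0r hMpos) (by exact_mod_cast hbM_le)
  have hposbM : 0 < Real.log (b:ℝ) + Real.log ((M : ℕ) : ℝ) := log_add_log_pos hb hbM
  have hinv4 : 1 / Real.log (2 * (Q:ℝ)) ≤ 1 / (Real.log b + Real.log ((M : ℕ) : ℝ)) :=
    one_div_le_one_div_of_le hposbM hlogbM'
  have hR2 : Real.log (R:ℝ) - Real.log 2 ≤ Real.log b + Real.log N₁ := by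
    have hN1pos : (0:ℝ) < N₁ := by exact_mod_cast (show 0 < N₁ by omega)
    have h2 : (R:ℝ) ≤ 2 * ((b:ℝ) * N₁) := by
      have h := Nat.lt_div_mul_add (a := R) (b := b) (by omega)
      have h' : (R:ℝ) < (N₁:ℝ) * b + b := by rw [hN₁]; exact_mod_cast h
      have hbQ' : (b:ℝ) ≤ Q := by exact_mod_cast hbQ
      have hQR' : 2 * (Q:ℝ) ≤ R := by exact_mod_cast hQR
      nlinarith
    have : Real.log R ≤ Real.log 2 + (Real.log b + Real.log N₁) := by
      rw [← Real.log_mul hb0r.ne' hN1pos.ne', ← Real.log_mul (by norm_num) (mul_pos hb0r hN1pos).ne']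
      exact Real.log_le_log (by exact_mod_cast (show 0 < R by omega)) h2
    linarith
  have hR3 : 0 < Real.log (R:ℝ) - Real.log 2 := by
    have : (2:ℝ) < R := by exact_mod_cast (show 2 < R by omega)
    have := Real.log_lt_log (by norm_num) this
    linarith
  have hinv5 : 1 / (Real.log (b:ℝ) + Real.log N₁) ≤ 1 / (Real.log R - Real.log 2) :=
    one_div_le_one_div_of_le hR3 hR2
  have hlog2 : 0 < Real.log 2 := Real.log_pos (by norm_num)
  have hc' : 0 ≤ c' := by
    have := hψ 1 le_rfl (by omega)
    simp [ArithmeticFunction.vonMangoldt_apply_one] at this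
    linarith
  rw [h0] at hup hlo
  have hcoef : (39 / 50 + c' + Real.log 2) / Real.log ((Q:ℝ) + 1) ^ 2 =
      39 / 50 * (1 / Real.log ((Q:ℝ) + 1) ^ 2) + (c' + Real.log 2) * (1 / Real.log ((Q:ℝ) + 1) ^ 2) := by ring
  rw [hcoef]
  nlinarith [hup, hlo, hadd, hmid, hinv2, hinv4, hinv5, hc', hlog2.le,
    mul_le_mul_of_nonneg_left hinv2 (by positivity : (0:ℝ) ≤ 39 / 50),
    mul_le_mul_of_nonneg_left hinv2 (by positivity : (0:ℝ) ≤ c' + Real.log 2)]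

end Summit.RiemannHypothesis.RiemannHypothesis.Theorems.IntegerScrew

end
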